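import Literature.NumberTheory.EllipticCurves.NewformsGaloisConjugate
import Literature.NumberTheory.EllipticCurves.NewformsGaloisConjugateProofs
import HarnessLib

/-!
# Discharge of the named fact `DiamondShurman2005_thm654_exists_isNewform0_conj` (Diamond–Shurman Thm. 6.5.4, weight 2, `Γ₀(N)`)

Topic `NumberTheory/EllipticCurves`. The fact of `NewformsGaloisConjugate.lean` is the weight-`2` case of the tree THEOREM
`GaloisConjugate.exists_isNewform0_conj` (`NewformsGaloisConjugateProofs.lean`, any weight `k ≥ 2`); this file records the one-line `_holds`.
-/

noncomputable section

namespace Literature.NumberTheory.EllipticCurves.ModularForms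

/-- **Diamond–Shurman Thm. 6.5.4 (weight 2, trivial character) HOLDS**: discharge of `DiamondShurman2005_thm654_exists_isNewform0_conj` by
`GaloisConjugate.exists_isNewform0_conj`. [cite: DiamondShurman2005, Thm. 6.5.4] -/
theorem DiamondShurman2005_thm654_exists_isNewform0_conj_holds : DiamondShurman2005_thm654_exists_isNewform0_conj :=
  fun _ _ f hf σ ↦ GaloisConjugate.exists_isNewform0_conj le_rfl f hf σ

end Literature.NumberTheory.EllipticCurves.ModularForms

end
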